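import Summits.AtomisticToContinuum.HydrodynamicLimit.Theorems.TwoClocksEquilibriumFastWindowLDBirthT12DipoleCommB
import Summits.AtomisticToContinuum.HydrodynamicLimit.Theorems.TwoClocksEquilibriumFastWindowLDBirthT12LorentzB
import Summits.AtomisticToContinuum.HydrodynamicLimit.Theorems.TwoClocksEquilibriumFastWindowLDBirthQuarticPreimage
import HarnessLib

/-!
# The exact sector equations (`ℓ = 0`, `ℓ = 1`, `ℓ ≥ 2`) of a solution of `L ψ = g`, pointwise and in profile form
# (helpers `t12_sectorEquation_zonal` (S0'), `t12_sectorEquation_dipole` (S1') of the line `birth`, crux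
# `TwoClocks.EquilibriumFastWindowLD`, stmt-AtomisticToContinuum-14440; plan §5 of the registered analytic
# sub-goal `t12_logLinearPreimage_and_dipoleModulus` — the equations the Euler–Volterra lemmas consume)

For the linearised hard-sphere operator `L = hardSphereLinearizedOp` of `ℝ³` (`M`-weighted picture,
`M = stdGaussian`) Grad's splitting reads, on measurable `ψ` of Gaussian growth `|ψ(x)| ≤ C e^{|x|²/4}`,
`Lψ = K₂ψ - K₁ψ - νψ` at EVERY point (`hardSphereLinearizedOp_eq_kernel_sub_of_gaussGrowth`,
`kernelAction_eq_gainTerm_sub`), with the gain term `K₂ = gainTerm` (`…T12LorentzB`), the partner-loss term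
`K₁u(v) = ∫ dM(w) ∫_{S²} ((v-w)·ω)₊ u(w) dσ(ω) = π∫|v-w| u(w) dM(w)` (here NAMED `lossTerm`; `…T12LossAsymptotics`
kept it anonymous) and `ν = collisionFrequency`. The sector projections `Π₀ = zonalAvg`, `Π₁ = dipolePart`,
`Π_{≥2} = higherPart` commute with `L` on that class (Z1 `hardSphereLinearizedOp_zonalAvg`, Z2
`hardSphereLinearizedOp_dipolePart`, `hardSphereLinearizedOp_higherPart`) and preserve it (constants `C`,
`3C`, `5C`). Writing `g := Lψ`, this file packages the EXACT equations of the three isotypic pieces: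

* (S0) `ν Π₀ψ = K₂(Π₀ψ) - K₁(Π₀ψ) - Π₀g`, (S1) `ν Π₁ψ = K₂(Π₁ψ) - K₁(Π₁ψ) - Π₁g`,
  (S2) `ν Π_{≥2}ψ = K₂(Π_{≥2}ψ) - K₁(Π_{≥2}ψ) - Π_{≥2}g`, at every `v` (`sectorEquation_zonalAvg/_dipolePart/_higherPart`);
* isotropy of each piece of the splitting, `K₂(u ∘ R)(v) = K₂u(Rv)`, `K₁(u ∘ R)(v) = K₁u(Rv)` for linear
  isometries `R` (no hypothesis), hence **`K₂`, `K₁` map radial functions to radial functions**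
  (`gainTerm_eq_of_radial`, `lossTerm_eq_of_radial`); continuity of `K₂u`, `K₁u` on the class;
* the PROFILE FORMS: (S0', registered `t12_sectorEquation_zonal`) with the radial profile
  `F(s) = (4π)⁻¹∫_{S²} ψ(sω) dσ(ω)` of `f := Π₀ψ = F ∘ |·|` and the zonal data `G₀(s) = (4π)⁻¹∫ g(sω) dσ`:
  **`ν(s e) F(s) = K₂f(s e) - K₁f(s e) - G₀(s)`** for every unit `e` and `s ≥ 0`, each term being independent
  of `e`; (S1', registered `t12_sectorEquation_dipole`) with `d := Π₁ψ = ⟪Φ_ψ(|·|), ·⟫`, `Φ_ψ = dipoleProfile ψ`: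
  **`ν(s e) Φ_ψ(s) = Φ_{K₂d}(s) - Φ_{K₁d}(s) - Φ_g(s)`** for `s > 0` (take the dipole profile of (S1):
  `Φ_{νd}(s) = ν(s)Φ_ψ(s)` because `ν` is radial, `Φ_{Π₁g} = Φ_g`);
* the a-priori sizes of the pieces under a radial majorant `|ψ(u)| ≤ W(|u|)` (`|Π₀ψ| ≤ W`, `|Π₁ψ| ≤ 3W`,
  `|Φ_ψ(s)| ≤ 3W(s)/s`, `|Π_{≥2}ψ| ≤ 5W`), `(1+s²)² ≤ 32e^{s²/4}`, and the package for the `M`-orthogonal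
  pre-image `ψ₀` of admissible quadratic data (`t12_quarticPreimage_of_quadraticData`: `|ψ₀| ≤ C C_g(1+|v|²)²`,
  hence Gaussian growth `32 C C_g`): `ψ₀` satisfies (S0)–(S2) with data `Π₀g`, `Π₁g`, `Π_{≥2}g`
  (`sectorEquations_quarticPreimage`).

NOT here: the far-field (Lorentz) evaluation of `K₂` on the sectors with rates (plan (e-K₂)), which turns
(S0')/(S1') into the Euler–Volterra equations of `…T12Euler`. References: Cercignani–Illner–Pulvirenti 1994
§7.2 (2.10)–(2.15) (Grad's splitting), §7.3 p. 209 (isotropy); Grad 1963 §4 (sectors). All statements [folklore].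
-/

noncomputable section

open MeasureTheory ProbabilityTheory Real Set Filter Metric
open scoped ENNReal BigOperators InnerProductSpace

namespace Summit.AtomisticToContinuum.HydrodynamicLimit.Theorems.ClampedCorrectorBirth

open Literature.Analysis.FluidPDE Literature.MathematicalPhysics.KineticTheory
open Literature.Analysis.UnboundedOperators

/-! ### The loss term; Grad's splitting solved for `νψ` -/

/-- **The partner-loss term `K₁u(v) := ∫ dM(w) ∫_{S²} ((v-w)·ω)₊ u(w) dσ(ω)`** (`= π ∫ |v-w| u(w) dM(w)`,
`lossTerm_eq_pi_mul_integral`) of Grad's splitting `L = K₂ - K₁ - ν` (CIP 1994 §7.2 (2.14)). [folklore] -/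
def lossTerm (u : EuclideanSpace ℝ (Fin 3) → ℝ) (v : EuclideanSpace ℝ (Fin 3)) : ℝ :=
  ∫ w, ∫ ω, hardSphereKernel (v, w) ω * u w ∂sphereMeasure ∂stdGaussian (EuclideanSpace ℝ (Fin 3))

variable {ψ : EuclideanSpace ℝ (Fin 3) → ℝ} {C : ℝ}

/-- `K₁u(v) = π ∫ |v - w| u(w) dM(w)` (hat-box theorem; no integrability needed). [folklore] -/
theorem lossTerm_eq_pi_mul (u : EuclideanSpace ℝ (Fin 3) → ℝ) (v : EuclideanSpace ℝ (Fin 3)) :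
    lossTerm u v = π * ∫ w, ‖v - w‖ * u w ∂stdGaussian (EuclideanSpace ℝ (Fin 3)) :=
  lossTerm_eq_pi_mul_integral u v

/-- **Grad's splitting, pointwise**: `Lψ(v) = K₂ψ(v) - K₁ψ(v) - ν(v)ψ(v)` for `ψ` measurable of Gaussian
growth. [folklore] -/
theorem hardSphereLinearizedOp_eq_gainTerm_sub (hψ : Measurable ψ)
    (hC : ∀ x, |ψ x| ≤ C * Real.exp (‖x‖ ^ 2 / 4)) (v : EuclideanSpace ℝ (Fin 3)) :
    hardSphereLinearizedOp ψ v = gainTerm ψ v - lossTerm ψ v - collisionFrequency v * ψ v := by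
  rw [hardSphereLinearizedOp_eq_kernel_sub_of_gaussGrowth hψ hC v, kernelAction_eq_gainTerm_sub hψ hC v]
  rfl

/-- **The equation `Lψ = g` solved for `νψ`**: `ν(v)ψ(v) = K₂ψ(v) - K₁ψ(v) - Lψ(v)` (Gaussian growth
class). [folklore] -/
theorem collisionFrequency_mul_eq_of_gaussGrowth (hψ : Measurable ψ)
    (hC : ∀ x, |ψ x| ≤ C * Real.exp (‖x‖ ^ 2 / 4)) (v : EuclideanSpace ℝ (Fin 3)) :
    collisionFrequency v * ψ v = gainTerm ψ v - lossTerm ψ v - hardSphereLinearizedOp ψ v := by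
  rw [hardSphereLinearizedOp_eq_gainTerm_sub hψ hC v]; ring

/-! ### Isotropy of the gain and loss terms; radial in, radial out; continuity -/

/-- One transported piece is isotropic: `∫dM∫ B u(A P(v,w,ω)) = ∫dM∫ B u(P(Av,w,ω))` whenever the
transported velocity `P` is `A`-equivariant (substitute `w ↦ Aw`, `ω ↦ Aω`; no integrability). [folklore] -/
theorem integral_integral_kernel_comp_linearIsometryEquiv (A : EuclideanSpace ℝ (Fin 3) ≃ₗᵢ[ℝ] EuclideanSpace ℝ (Fin 3))
    (u : EuclideanSpace ℝ (Fin 3) → ℝ)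
    (P : EuclideanSpace ℝ (Fin 3) → EuclideanSpace ℝ (Fin 3) → sphere (0 : EuclideanSpace ℝ (Fin 3)) 1 →
      EuclideanSpace ℝ (Fin 3))
    (hP : ∀ v w ω, P (A v) (A w) ((mapsTo_sphere_linearIsometryEquiv A).restrict A _ _ ω) = A (P v w ω))
    (v : EuclideanSpace ℝ (Fin 3)) :
    ∫ w, ∫ ω, hardSphereKernel (v, w) ω * u (A (P v w ω)) ∂sphereMeasure ∂stdGaussian (EuclideanSpace ℝ (Fin 3)) =
      ∫ w, ∫ ω, hardSphereKernel (A v, w) ω * u (P (A v) w ω) ∂sphereMeasure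
        ∂stdGaussian (EuclideanSpace ℝ (Fin 3)) := by
  refine Eq.trans ?_ ((measurePreserving_linearIsometryEquiv_stdGaussian A).integral_comp
    A.toHomeomorph.measurableEmbedding _)
  congr 1
  funext w
  refine Eq.trans ?_ (integral_sphere_comp_isometry A _)
  congr 1
  funext ω
  rw [hardSphereKernel_linearIsometryEquiv A v w ω, hP]

/-- **The gain term is isotropic**: `K₂(u ∘ R)(v) = K₂u(Rv)` for every linear isometry `R` and every `u`.
[folklore] -/
theorem gainTerm_comp_linearIsometryEquiv (A : EuclideanSpace ℝ (Fin 3) ≃ₗᵢ[ℝ] EuclideanSpace ℝ (Fin 3))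
    (u : EuclideanSpace ℝ (Fin 3) → ℝ) (v : EuclideanSpace ℝ (Fin 3)) : gainTerm (u ∘ A) v = gainTerm u (A v) := by
  unfold gainTerm
  simp only [Function.comp_apply]
  rw [integral_integral_kernel_comp_linearIsometryEquiv A u (fun v w ω => (collide ω (v, w)).1)
      (fun v w ω => by rw [collide_linearIsometryEquiv]) v,
    integral_integral_kernel_comp_linearIsometryEquiv A u (fun v w ω => (collide ω (v, w)).2)
      (fun v w ω => by rw [collide_linearIsometryEquiv]) v]

/-- **The loss term is isotropic**: `K₁(u ∘ R)(v) = K₁u(Rv)` for every linear isometry `R` and every `u`.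
[folklore] -/
theorem lossTerm_comp_linearIsometryEquiv (A : EuclideanSpace ℝ (Fin 3) ≃ₗᵢ[ℝ] EuclideanSpace ℝ (Fin 3))
    (u : EuclideanSpace ℝ (Fin 3) → ℝ) (v : EuclideanSpace ℝ (Fin 3)) : lossTerm (u ∘ A) v = lossTerm u (A v) := by
  unfold lossTerm
  simp only [Function.comp_apply]
  exact integral_integral_kernel_comp_linearIsometryEquiv A u (fun _ w _ => w) (fun _ _ _ => rfl) v

/-- **`K₂` maps radial functions to radial functions**: `|v| = |v'| ⟹ K₂f(v) = K₂f(v')` for radial `f`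
(reflection exchanging `v, v'`). [folklore] -/
theorem gainTerm_eq_of_radial {f : EuclideanSpace ℝ (Fin 3) → ℝ}
    (hf : ∀ u u' : EuclideanSpace ℝ (Fin 3), ‖u‖ = ‖u'‖ → f u = f u') {v v' : EuclideanSpace ℝ (Fin 3)}
    (h : ‖v‖ = ‖v'‖) : gainTerm f v = gainTerm f v' := by
  have hA : f ∘ ((ℝ ∙ (v - v'))ᗮ.reflection) = f := funext fun u => hf _ _ (LinearIsometryEquiv.norm_map _ _)
  rw [← Submodule.reflection_sub h, ← gainTerm_comp_linearIsometryEquiv, hA]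

/-- **`K₁` maps radial functions to radial functions**: `|v| = |v'| ⟹ K₁f(v) = K₁f(v')` for radial `f`.
[folklore] -/
theorem lossTerm_eq_of_radial {f : EuclideanSpace ℝ (Fin 3) → ℝ}
    (hf : ∀ u u' : EuclideanSpace ℝ (Fin 3), ‖u‖ = ‖u'‖ → f u = f u') {v v' : EuclideanSpace ℝ (Fin 3)}
    (h : ‖v‖ = ‖v'‖) : lossTerm f v = lossTerm f v' := by
  have hA : f ∘ ((ℝ ∙ (v - v'))ᗮ.reflection) = f := funext fun u => hf _ _ (LinearIsometryEquiv.norm_map _ _)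
  rw [← Submodule.reflection_sub h, ← lossTerm_comp_linearIsometryEquiv, hA]

/-- `K₂ψ` is continuous for `ψ` measurable of Gaussian growth (both gain pieces are the Carleman gain).
[folklore] -/
theorem continuous_gainTerm_of_gaussGrowth (hψ : Measurable ψ) (hC : ∀ x, |ψ x| ≤ C * Real.exp (‖x‖ ^ 2 / 4)) :
    Continuous (gainTerm ψ) := by
  have h : gainTerm ψ = fun v => 2 * carlemanGain 1 ψ v := by
    funext v
    rw [gainTerm, integral_integral_gain_snd_eq_fst hψ hC v, integral_integral_gain_fst_eq_carlemanGain hψ hC v]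
    ring
  rw [h]
  exact continuous_const.mul (continuous_carlemanGain_of_gaussGrowth hψ hC)

/-- `K₁ψ` is continuous for `ψ` measurable of Gaussian growth (dominated convergence). [folklore] -/
theorem continuous_lossTerm_of_gaussGrowth (hψ : Measurable ψ) (hC : ∀ x, |ψ x| ≤ C * Real.exp (‖x‖ ^ 2 / 4)) :
    Continuous (lossTerm ψ) :=
  continuous_integral_integral_kernel_mul_of_gaussGrowth hψ hC

/-! ### (S0), (S1), (S2): the pointwise sector equations -/

/-- **(S0) the zonal sector equation**: with `f := Π₀ψ` and `g := Lψ`,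
`ν(v) f(v) = K₂f(v) - K₁f(v) - Π₀g(v)` at every `v` (`LΠ₀ = Π₀L`, Z1). [folklore] -/
theorem sectorEquation_zonalAvg (hψ : Measurable ψ) (hC : ∀ x, |ψ x| ≤ C * Real.exp (‖x‖ ^ 2 / 4))
    (v : EuclideanSpace ℝ (Fin 3)) :
    collisionFrequency v * zonalAvg ψ v =
      gainTerm (zonalAvg ψ) v - lossTerm (zonalAvg ψ) v - zonalAvg (hardSphereLinearizedOp ψ) v := by
  rw [← hardSphereLinearizedOp_zonalAvg hψ hC v]
  exact collisionFrequency_mul_eq_of_gaussGrowth (measurable_zonalAvg hψ) (abs_zonalAvg_le_gauss hC) v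

/-- **(S1) the dipole sector equation**: with `d := Π₁ψ` and `g := Lψ`,
`ν(v) d(v) = K₂d(v) - K₁d(v) - Π₁g(v)` at every `v` (`LΠ₁ = Π₁L`, Z2). [folklore] -/
theorem sectorEquation_dipolePart (hψ : Measurable ψ) (hC : ∀ x, |ψ x| ≤ C * Real.exp (‖x‖ ^ 2 / 4))
    (v : EuclideanSpace ℝ (Fin 3)) :
    collisionFrequency v * dipolePart ψ v =
      gainTerm (dipolePart ψ) v - lossTerm (dipolePart ψ) v - dipolePart (hardSphereLinearizedOp ψ) v := by
  rw [← hardSphereLinearizedOp_dipolePart hψ hC v]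
  exact collisionFrequency_mul_eq_of_gaussGrowth (measurable_dipolePart hψ) (abs_dipolePart_le_gauss hC) v

/-- **(S2) the higher (`ℓ ≥ 2`) sector equation**: with `h := Π_{≥2}ψ` and `g := Lψ`,
`ν(v) h(v) = K₂h(v) - K₁h(v) - Π_{≥2}g(v)` at every `v`. [folklore] -/
theorem sectorEquation_higherPart (hψ : Measurable ψ) (hC : ∀ x, |ψ x| ≤ C * Real.exp (‖x‖ ^ 2 / 4))
    (v : EuclideanSpace ℝ (Fin 3)) :
    collisionFrequency v * higherPart ψ v =
      gainTerm (higherPart ψ) v - lossTerm (higherPart ψ) v - higherPart (hardSphereLinearizedOp ψ) v := by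
  rw [← hardSphereLinearizedOp_higherPart hψ hC v]
  exact collisionFrequency_mul_eq_of_gaussGrowth (measurable_higherPart hψ) (abs_higherPart_le_gauss hC) v

/-! ### (S0'), (S1'): the profile forms along a ray `s ↦ s e` -/

/-- `|s e| = |s|` for a unit vector `e`. [folklore] -/
theorem norm_smul_sphere (s : ℝ) (e : sphere (0 : EuclideanSpace ℝ (Fin 3)) 1) :
    ‖s • (e : EuclideanSpace ℝ (Fin 3))‖ = |s| := by
  rw [norm_smul, norm_eq_of_mem_sphere e, mul_one, Real.norm_eq_abs]

/-- The radial profile of the zonal average: `Π₀ψ(s e) = (4π)⁻¹∫_{S²} ψ(sω) dσ(ω)` for `s ≥ 0`. [folklore] -/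
theorem zonalAvg_smul_sphere (ψ : EuclideanSpace ℝ (Fin 3) → ℝ) {s : ℝ} (hs : 0 ≤ s)
    (e : sphere (0 : EuclideanSpace ℝ (Fin 3)) 1) :
    zonalAvg ψ (s • (e : EuclideanSpace ℝ (Fin 3))) = (4 * π)⁻¹ *
      ∫ ω : sphere (0 : EuclideanSpace ℝ (Fin 3)) 1, ψ (s • (ω : EuclideanSpace ℝ (Fin 3))) ∂sphereMeasure := by
  unfold zonalAvg; rw [norm_smul_sphere, abs_of_nonneg hs]

/-- The three coefficients of (S0') do not depend on the direction `e`: `ν(s e)`, `K₂(Π₀ψ)(s e)`,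
`K₁(Π₀ψ)(s e)` are functions of `s` alone (`ν`, `K₂`, `K₁` are isotropic and `Π₀ψ` is radial). [folklore] -/
theorem sectorCoeff_zonal_indep (ψ : EuclideanSpace ℝ (Fin 3) → ℝ) (s : ℝ)
    (e e' : sphere (0 : EuclideanSpace ℝ (Fin 3)) 1) :
    collisionFrequency (s • (e : EuclideanSpace ℝ (Fin 3))) = collisionFrequency (s • (e' : EuclideanSpace ℝ (Fin 3))) ∧
      gainTerm (zonalAvg ψ) (s • (e : EuclideanSpace ℝ (Fin 3))) = gainTerm (zonalAvg ψ) (s • (e' : EuclideanSpace ℝ (Fin 3))) ∧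
      lossTerm (zonalAvg ψ) (s • (e : EuclideanSpace ℝ (Fin 3))) = lossTerm (zonalAvg ψ) (s • (e' : EuclideanSpace ℝ (Fin 3))) := by
  have h : ‖s • (e : EuclideanSpace ℝ (Fin 3))‖ = ‖s • (e' : EuclideanSpace ℝ (Fin 3))‖ := by
    rw [norm_smul_sphere, norm_smul_sphere]
  exact ⟨collisionFrequency_eq_of_norm_eq h, gainTerm_eq_of_radial (fun _ _ h' => zonalAvg_eq_of_norm_eq ψ h') h,
    lossTerm_eq_of_radial (fun _ _ h' => zonalAvg_eq_of_norm_eq ψ h') h⟩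

/-- **(S0') the zonal sector equation in profile form**: with `F(s) := (4π)⁻¹∫ ψ(sω) dσ` (so that
`Π₀ψ = F ∘ |·|`) and `G₀(s) := (4π)⁻¹∫ (Lψ)(sω) dσ`, for every unit `e` and `s ≥ 0`:
`ν(s e) F(s) = K₂(Π₀ψ)(s e) - K₁(Π₀ψ)(s e) - G₀(s)`. [folklore] -/
theorem sectorEquation_zonal_profile (hψ : Measurable ψ) (hC : ∀ x, |ψ x| ≤ C * Real.exp (‖x‖ ^ 2 / 4))
    (e : sphere (0 : EuclideanSpace ℝ (Fin 3)) 1) {s : ℝ} (hs : 0 ≤ s) :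
    collisionFrequency (s • (e : EuclideanSpace ℝ (Fin 3))) *
        ((4 * π)⁻¹ * ∫ ω : sphere (0 : EuclideanSpace ℝ (Fin 3)) 1, ψ (s • (ω : EuclideanSpace ℝ (Fin 3))) ∂sphereMeasure) =
      gainTerm (zonalAvg ψ) (s • (e : EuclideanSpace ℝ (Fin 3))) - lossTerm (zonalAvg ψ) (s • (e : EuclideanSpace ℝ (Fin 3))) -
        (4 * π)⁻¹ * ∫ ω : sphere (0 : EuclideanSpace ℝ (Fin 3)) 1,
          hardSphereLinearizedOp ψ (s • (ω : EuclideanSpace ℝ (Fin 3))) ∂sphereMeasure := by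
  rw [← zonalAvg_smul_sphere ψ hs e, ← zonalAvg_smul_sphere (hardSphereLinearizedOp ψ) hs e]
  exact sectorEquation_zonalAvg hψ hC _

/-- `Φ_{Π₁g} = Φ_g` on `(0, ∞)` (idempotence of the dipole projection, profile form). [folklore] -/
theorem dipoleProfile_dipolePart' (g : EuclideanSpace ℝ (Fin 3) → ℝ) {s : ℝ} (hs : 0 < s) :
    dipoleProfile (dipolePart g) s = dipoleProfile g s :=
  dipoleProfile_dipolePart g hs

/-- **`ν` is radial, so it passes through the dipole profile**: `Φ_{ν·Π₁ψ}(s) = ν(s e) Φ_ψ(s)` for `s > 0`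
and any unit `e` (`ν(v)⟪Φ_ψ(|v|), v⟫ = ⟪ν(|v|e)Φ_ψ(|v|), v⟫` is a dipole field; `dipoleProfile_dipole`). [folklore] -/
theorem dipoleProfile_collisionFrequency_mul_dipolePart (ψ : EuclideanSpace ℝ (Fin 3) → ℝ) {s : ℝ} (hs : 0 < s)
    (e : sphere (0 : EuclideanSpace ℝ (Fin 3)) 1) :
    dipoleProfile (fun v => collisionFrequency v * dipolePart ψ v) s =
      collisionFrequency (s • (e : EuclideanSpace ℝ (Fin 3))) • dipoleProfile ψ s := by
  have h : (fun v : EuclideanSpace ℝ (Fin 3) => collisionFrequency v * dipolePart ψ v) =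
      fun v => ⟪collisionFrequency (‖v‖ • (e : EuclideanSpace ℝ (Fin 3))) • dipoleProfile ψ ‖v‖, v⟫_ℝ := by
    funext v
    rw [real_inner_smul_left, collisionFrequency_eq_of_norm_eq (v := v)
      (w := ‖v‖ • (e : EuclideanSpace ℝ (Fin 3))) (by rw [norm_smul_sphere, abs_norm])]
    rfl
  rw [h, dipoleProfile_dipole (fun r => collisionFrequency (r • (e : EuclideanSpace ℝ (Fin 3))) • dipoleProfile ψ r) hs]

/-- The trace of a dipole part on a sphere is continuous, hence `σ`-integrable (whatever `g`). [folklore] -/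
theorem integrable_sphere_trace_dipolePart (g : EuclideanSpace ℝ (Fin 3) → ℝ) (s : ℝ) :
    Integrable (fun ω : sphere (0 : EuclideanSpace ℝ (Fin 3)) 1 => dipolePart g (s • (ω : EuclideanSpace ℝ (Fin 3))))
      sphereMeasure := by
  have h : (fun ω : sphere (0 : EuclideanSpace ℝ (Fin 3)) 1 => dipolePart g (s • (ω : EuclideanSpace ℝ (Fin 3)))) =
      fun ω : sphere (0 : EuclideanSpace ℝ (Fin 3)) 1 => ⟪dipoleProfile g |s|, s • (ω : EuclideanSpace ℝ (Fin 3))⟫_ℝ := by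
    funext ω; unfold dipolePart; rw [norm_smul_sphere]
  rw [h]
  exact integrable_sphere_of_continuous' (by fun_prop)

/-- **(S1') the dipole sector equation in profile form**: with `d := Π₁ψ = ⟪Φ_ψ(|·|), ·⟫` and `g := Lψ`,
for `s > 0` and any unit `e`: `ν(s e) Φ_ψ(s) = Φ_{K₂d}(s) - Φ_{K₁d}(s) - Φ_g(s)` (dipole profile of (S1);
`K₂d`, `K₁d` are continuous, `Φ_{Π₁g} = Φ_g`). [folklore] -/
theorem sectorEquation_dipole_profile (hψ : Measurable ψ) (hC : ∀ x, |ψ x| ≤ C * Real.exp (‖x‖ ^ 2 / 4))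
    {s : ℝ} (hs : 0 < s) (e : sphere (0 : EuclideanSpace ℝ (Fin 3)) 1) :
    collisionFrequency (s • (e : EuclideanSpace ℝ (Fin 3))) • dipoleProfile ψ s =
      dipoleProfile (gainTerm (dipolePart ψ)) s - dipoleProfile (lossTerm (dipolePart ψ)) s -
        dipoleProfile (hardSphereLinearizedOp ψ) s := by
  have hdm := measurable_dipolePart hψ
  have hdC := abs_dipolePart_le_gauss hC
  have i1 : Integrable (fun ω : sphere (0 : EuclideanSpace ℝ (Fin 3)) 1 =>
      gainTerm (dipolePart ψ) (s • (ω : EuclideanSpace ℝ (Fin 3)))) sphereMeasure :=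
    integrable_sphere_trace_of_continuous (continuous_gainTerm_of_gaussGrowth hdm hdC) s
  have i2 : Integrable (fun ω : sphere (0 : EuclideanSpace ℝ (Fin 3)) 1 =>
      lossTerm (dipolePart ψ) (s • (ω : EuclideanSpace ℝ (Fin 3)))) sphereMeasure :=
    integrable_sphere_trace_of_continuous (continuous_lossTerm_of_gaussGrowth hdm hdC) s
  have i12 : Integrable (fun ω : sphere (0 : EuclideanSpace ℝ (Fin 3)) 1 =>
      gainTerm (dipolePart ψ) (s • (ω : EuclideanSpace ℝ (Fin 3))) -
        lossTerm (dipolePart ψ) (s • (ω : EuclideanSpace ℝ (Fin 3)))) sphereMeasure := i1.sub i2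
  have i3 := integrable_sphere_trace_dipolePart (hardSphereLinearizedOp ψ) s
  calc collisionFrequency (s • (e : EuclideanSpace ℝ (Fin 3))) • dipoleProfile ψ s
      = dipoleProfile (fun v => collisionFrequency v * dipolePart ψ v) s :=
        (dipoleProfile_collisionFrequency_mul_dipolePart ψ hs e).symm
    _ = dipoleProfile (fun v => (gainTerm (dipolePart ψ) v - lossTerm (dipolePart ψ) v) -
          dipolePart (hardSphereLinearizedOp ψ) v) s :=
        dipoleProfile_congr fun ω => sectorEquation_dipolePart hψ hC _
    _ = _ := by
        rw [dipoleProfile_sub (ψ₁ := fun v => gainTerm (dipolePart ψ) v - lossTerm (dipolePart ψ) v) i12 i3,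
          dipoleProfile_sub (ψ₁ := gainTerm (dipolePart ψ)) (ψ₂ := lossTerm (dipolePart ψ)) i1 i2,
          dipoleProfile_dipolePart' _ hs]

/-! ### A-priori sizes of the pieces; the orthogonal pre-image of admissible data -/

variable {W : ℝ → ℝ}

/-- A radial majorant passes to the zonal average: `|ψ(u)| ≤ W(|u|) ⟹ |Π₀ψ(v)| ≤ W(|v|)`. [folklore] -/
theorem abs_zonalAvg_le_radial (h : ∀ u, |ψ u| ≤ W ‖u‖) (v : EuclideanSpace ℝ (Fin 3)) : |zonalAvg ψ v| ≤ W ‖v‖ :=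
  abs_zonalAvg_le fun ω => by
    have := h (‖v‖ • (ω : EuclideanSpace ℝ (Fin 3)))
    rwa [norm_smul_sphere, abs_norm] at this

/-- `|ψ(u)| ≤ W(|u|) ⟹ |Π₁ψ(v)| ≤ 3 W(|v|)`. [folklore] -/
theorem abs_dipolePart_le_radial (h : ∀ u, |ψ u| ≤ W ‖u‖) (v : EuclideanSpace ℝ (Fin 3)) :
    |dipolePart ψ v| ≤ 3 * W ‖v‖ :=
  abs_dipolePart_le fun u hu => by rw [← hu]; exact h u

/-- `|ψ(u)| ≤ W(|u|) ⟹ |Φ_ψ(s)| ≤ 3 W(s) / s` for `s > 0`. [folklore] -/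
theorem norm_dipoleProfile_le_radial (h : ∀ u, |ψ u| ≤ W ‖u‖) {s : ℝ} (hs : 0 < s) :
    ‖dipoleProfile ψ s‖ ≤ 3 * W s / s :=
  norm_dipoleProfile_le hs fun ω => by
    have := h (s • (ω : EuclideanSpace ℝ (Fin 3)))
    rwa [norm_smul_sphere, abs_of_pos hs] at this

/-- `|ψ(u)| ≤ W(|u|) ⟹ |Π_{≥2}ψ(v)| ≤ 5 W(|v|)`. [folklore] -/
theorem abs_higherPart_le_radial (h : ∀ u, |ψ u| ≤ W ‖u‖) (v : EuclideanSpace ℝ (Fin 3)) :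
    |higherPart ψ v| ≤ 5 * W ‖v‖ := by
  have h0 := h v
  have h1 := abs_zonalAvg_le_radial h v
  have h2 := abs_dipolePart_le_radial h v
  unfold higherPart
  have h3 := abs_sub (ψ v - zonalAvg ψ v) (dipolePart ψ v)
  have h4 := abs_sub (ψ v) (zonalAvg ψ v)
  linarith

/-- **Quartic growth is Gaussian growth**: `(1 + s²)² ≤ 32 e^{s²/4}` (`e^x ≥ 1 + x + x²/2`). [folklore] -/
theorem one_add_sq_sq_le_exp (s : ℝ) : (1 + s ^ 2) ^ 2 ≤ 32 * Real.exp (s ^ 2 / 4) := by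
  have h := Real.quadratic_le_exp_of_nonneg (by positivity : (0 : ℝ) ≤ s ^ 2 / 4)
  nlinarith [sq_nonneg s, sq_nonneg (s ^ 2)]

/-- A quartic bound `|ψ| ≤ A(1+|v|²)²` is a Gaussian-growth bound with constant `32A`. [folklore] -/
theorem gaussGrowth_of_quartic {A : ℝ} (h : ∀ v, |ψ v| ≤ A * (1 + ‖v‖ ^ 2) ^ 2) (x : EuclideanSpace ℝ (Fin 3)) :
    |ψ x| ≤ 32 * A * Real.exp (‖x‖ ^ 2 / 4) := by
  have hA : 0 ≤ A := by
    have h0 := h 0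
    rw [norm_zero] at h0
    norm_num at h0
    exact (abs_nonneg _).trans h0
  calc |ψ x| ≤ A * (1 + ‖x‖ ^ 2) ^ 2 := h x
    _ ≤ A * (32 * Real.exp (‖x‖ ^ 2 / 4)) := mul_le_mul_of_nonneg_left (one_add_sq_sq_le_exp ‖x‖) hA
    _ = 32 * A * Real.exp (‖x‖ ^ 2 / 4) := by ring

/-- **The sector equations of the orthogonal pre-image of admissible data.** There is an absolute `C > 0`
such that for every continuous `g` with `|g| ≤ C_g(1+|v|²)`, supported in a ball and `M`-orthogonal to the
collision invariants, the `M`-orthogonal pre-image `ψ₀` (`Lψ₀ = g` everywhere, continuous, `L²(M)`,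
`|ψ₀| ≤ C C_g (1+|v|²)²`, `t12_quarticPreimage_of_quadraticData`) has Gaussian growth `32 C C_g` and its three
isotypic pieces solve (S0), (S1), (S2) with data `Π₀g`, `Π₁g`, `Π_{≥2}g` at every `v`. [folklore] -/
theorem sectorEquations_quarticPreimage : ∃ C : ℝ, 0 < C ∧ ∀ (g : EuclideanSpace ℝ (Fin 3) → ℝ) (Cg R : ℝ),
    Continuous g → (∀ v, |g v| ≤ Cg * (1 + ‖v‖ ^ 2)) → (∀ v, R ≤ ‖v‖ → g v = 0) →
    (∀ φ ∈ collisionInvariants (EuclideanSpace ℝ (Fin 3)), maxwellianInner g φ = 0) →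
    ∃ ψ₀ : EuclideanSpace ℝ (Fin 3) → ℝ, Continuous ψ₀ ∧
      MemLp ψ₀ 2 (stdGaussian (EuclideanSpace ℝ (Fin 3))) ∧
      (∀ φ ∈ collisionInvariants (EuclideanSpace ℝ (Fin 3)), maxwellianInner ψ₀ φ = 0) ∧
      (∀ v, hardSphereLinearizedOp ψ₀ v = g v) ∧ (∀ v, |ψ₀ v| ≤ C * Cg * (1 + ‖v‖ ^ 2) ^ 2) ∧
      (∀ x, |ψ₀ x| ≤ 32 * (C * Cg) * Real.exp (‖x‖ ^ 2 / 4)) ∧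
      (∀ v, collisionFrequency v * zonalAvg ψ₀ v =
        gainTerm (zonalAvg ψ₀) v - lossTerm (zonalAvg ψ₀) v - zonalAvg g v) ∧
      (∀ v, collisionFrequency v * dipolePart ψ₀ v =
        gainTerm (dipolePart ψ₀) v - lossTerm (dipolePart ψ₀) v - dipolePart g v) ∧
      ∀ v, collisionFrequency v * higherPart ψ₀ v =
        gainTerm (higherPart ψ₀) v - lossTerm (higherPart ψ₀) v - higherPart g v := by
  obtain ⟨C, hC, h⟩ := t12_quarticPreimage_of_quadraticData
  refine ⟨C, hC, fun g Cg R hg hgb hsupp horth => ?_⟩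
  obtain ⟨ψ₀, hcont, hq, hmem, horth', hL⟩ := h g Cg R hg hgb hsupp horth
  have hG := gaussGrowth_of_quartic hq
  have hLg : hardSphereLinearizedOp ψ₀ = g := funext hL
  refine ⟨ψ₀, hcont, hmem, horth', hL, hq, hG, fun v => ?_, fun v => ?_, fun v => ?_⟩
  · simpa only [hLg] using sectorEquation_zonalAvg hcont.measurable hG v
  · simpa only [hLg] using sectorEquation_dipolePart hcont.measurable hG v
  · simpa only [hLg] using sectorEquation_higherPart hcont.measurable hG v

/-! ### Registered helpers -/

/-- **Registered helper `t12_sectorEquation_zonal` (S0', plan §5).** For `ψ` measurable of Gaussian growth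
`|ψ| ≤ C e^{|·|²/4}` on `ℝ³`, with `f := Π₀ψ` (`zonalAvg ψ`, the radial function `F ∘ |·|`,
`F(s) = (4π)⁻¹∫_{S²} ψ(sω) dσ(ω)`), for every unit vector `e` and every `s ≥ 0`:
`ν(s e) F(s) = K₂f(s e) - K₁f(s e) - (4π)⁻¹∫_{S²} (Lψ)(sω) dσ(ω)` — the EXACT `ℓ = 0` sector equation of
`Lψ = g` as an identity between functions of the speed `s` (`K₂ = gainTerm`, `K₁` the partner-loss term written
out, `ν = collisionFrequency`; all three coefficients are independent of `e`, `sectorCoeff_zonal_indep`). Its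
far-field evaluation is the `ℓ = 0` Euler–Volterra equation of `t12_euler_zonal_quadraticPlusLinear`. [folklore] -/
theorem t12_sectorEquation_zonal : ∀ (ψ : EuclideanSpace ℝ (Fin 3) → ℝ) (C : ℝ), Measurable ψ → (∀ x, |ψ x| ≤ C * Real.exp (‖x‖ ^ 2 / 4)) → ∀ (e : Metric.sphere (0 : EuclideanSpace ℝ (Fin 3)) 1) (s : ℝ), 0 ≤ s → Literature.Analysis.UnboundedOperators.collisionFrequency (s • (e : EuclideanSpace ℝ (Fin 3))) * ((4 * Real.pi)⁻¹ * ∫ ω : Metric.sphere (0 : EuclideanSpace ℝ (Fin 3)) 1, ψ (s • (ω : EuclideanSpace ℝ (Fin 3))) ∂Literature.MathematicalPhysics.KineticTheory.sphereMeasure) = Summit.AtomisticToContinuum.HydrodynamicLimit.Theorems.ClampedCorrectorBirth.gainTerm (Summit.AtomisticToContinuum.HydrodynamicLimit.Theorems.ClampedCorrectorBirth.zonalAvg ψ) (s • (e : EuclideanSpace ℝ (Fin 3))) - (∫ w, ∫ ω, Literature.MathematicalPhysics.KineticTheory.hardSphereKernel (s • (e : EuclideanSpace ℝ (Fin 3)),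 w) ω * Summit.AtomisticToContinuum.HydrodynamicLimit.Theorems.ClampedCorrectorBirth.zonalAvg ψ w ∂Literature.MathematicalPhysics.KineticTheory.sphereMeasure ∂ProbabilityTheory.stdGaussian (EuclideanSpace ℝ (Fin 3))) - (4 * Real.pi)⁻¹ * ∫ ω : Metric.sphere (0 : EuclideanSpace ℝ (Fin 3)) 1, Literature.Analysis.UnboundedOperators.hardSphereLinearizedOp ψ (s • (ω : EuclideanSpace ℝ (Fin 3))) ∂Literature.MathematicalPhysics.KineticTheory.sphereMeasure :=
  fun _ _ hψ hC e _ hs => sectorEquation_zonal_profile hψ hC e hs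

/-- **Registered helper `t12_sectorEquation_dipole` (S1', plan §5).** For `ψ` measurable of Gaussian growth
`|ψ| ≤ C e^{|·|²/4}` on `ℝ³`, with the dipole part `d := Π₁ψ = ⟪Φ_ψ(|·|), ·⟫` (`dipolePart ψ`,
`Φ_ψ = dipoleProfile ψ`), for every unit vector `e` and every `s > 0`:
`ν(s e) Φ_ψ(s) = Φ_{K₂d}(s) - Φ_{K₁d}(s) - Φ_{Lψ}(s)` — the EXACT `ℓ = 1` sector equation of `Lψ = g` for the
vector profile (`K₂ = gainTerm`, `K₁` the partner-loss term written out, `ν = collisionFrequency`, radial). Its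
far-field evaluation is the `ℓ = 1` Euler–Volterra equation whose log-modulus is `t12_euler_dipole_logModulus`
(T2 of `t12_logLinearPreimage_and_dipoleModulus`). [folklore] -/
theorem t12_sectorEquation_dipole : ∀ (ψ : EuclideanSpace ℝ (Fin 3) → ℝ) (C : ℝ), Measurable ψ → (∀ x, |ψ x| ≤ C * Real.exp (‖x‖ ^ 2 / 4)) → ∀ (e : Metric.sphere (0 : EuclideanSpace ℝ (Fin 3)) 1) (s : ℝ), 0 < s → Literature.Analysis.UnboundedOperators.collisionFrequency (s • (e : EuclideanSpace ℝ (Fin 3))) • Summit.AtomisticToContinuum.HydrodynamicLimit.Theorems.ClampedCorrectorBirth.dipoleProfile ψ s = Summit.AtomisticToContinuum.HydrodynamicLimit.Theorems.ClampedCorrectorBirth.dipoleProfile (Summit.AtomisticToContinuum.HydrodynamicLimit.Theorems.ClampedCorrectorBirth.gainTerm (Summit.AtomisticToContinuum.HydrodynamicLimit.Theorems.ClampedCorrectorBirth.dipolePart ψ)) s - Summit.AtomisticToContinuum.HydrodynamicLimit.Theorems.ClampedCorrectorBirth.dipoleProfile (fun v : EuclideanSpace ℝ (Fin 3) => ∫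 w, ∫ ω, Literature.MathematicalPhysics.KineticTheory.hardSphereKernel (v, w) ω * Summit.AtomisticToContinuum.HydrodynamicLimit.Theorems.ClampedCorrectorBirth.dipolePart ψ w ∂Literature.MathematicalPhysics.KineticTheory.sphereMeasure ∂ProbabilityTheory.stdGaussian (EuclideanSpace ℝ (Fin 3))) s - Summit.AtomisticToContinuum.HydrodynamicLimit.Theorems.ClampedCorrectorBirth.dipoleProfile (Literature.Analysis.UnboundedOperators.hardSphereLinearizedOp ψ) s :=
  fun _ _ hψ hC e _ hs => sectorEquation_dipole_profile hψ hC hs e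

end Summit.AtomisticToContinuum.HydrodynamicLimit.Theorems.ClampedCorrectorBirth

end
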